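import Literature.NumberTheory.LFunctions.TypicalOrdinateLadder
import HarnessLib

/-!
# Counting the integers `n ∈ [T, 2T[` with `V_n = V` (Balazard–de Roton 2008, §8.4, from Proposition 20)

Topic `Literature/NumberTheory/LFunctions`; a brick of the reduction of
`Literature.NumberTheory.LFunctions.BalazardDeRoton2010_thm1` to the engine statements of
Soundararajan's method. M. Balazard, A. de Roton, arXiv:0810.3587, §8.4 (proof of Prop. 24):

> Considérons maintenant la contribution des `V > 2(log log T)²+1`. Si `T ≤ n < 2T` et `V_n = V`, la
> minimalité de `V_n` entraîne l'existence dans l'intervalle `[n, n+1]` de `t_n`, ordonnée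
> `(V_n − 1)`-atypique de taille `T`. En évitant de prendre des nombres consécutifs, on partitionne
> alors l'ensemble `{n, T ≤ n < 2T, V_n = V}` en (au plus) deux sous-ensembles, chacun étant de même
> cardinal qu'un ensemble d'ordonnées `(V_n−1)`-atypiques de taille `T`, bien espacées dans `[T, 2T]`.
> La proposition 20 donne alors
> `card{n, T ≤ n < 2T, V_n = V} ≪ T exp(−(V−1) log((V−1)/log log T) + 2(V−1) log log(V−1) + O(V))`.

With `TypicalCounting.Prop20With δ C D T₀` the conclusion of Proposition 20 for a fixed `δ` (a
predicate, taken as a hypothesis), `TypicalCounting.card_ladder_eq_le` proves exactly this: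
`#{n ∈ [T, 2T[ : V_n = V} ≤ 2·C·T·exp(−(V−1)log((V−1)/log log T) + 2(V−1) log log(V−1) + D(V−1))`
for integers `V ≥ 2(log log T)² + 1`, provided every `[n, n+1] ⊆ [T, 2T]` has an admissible integer
(which `TypicalLadder.admissible_vStar` supplies from Proposition 18).

## References

* [BalazardRoton2008] M. Balazard, A. de Roton, arXiv:0810.3587, §8.4 (proof of Prop. 24) and
  Prop. 20.
-/

noncomputable section

open Real

namespace Literature.NumberTheory.LFunctions

namespace TypicalCounting

open Soundararajan TypicalLadder

/-- The statement of Balazard–de Roton 2008, Proposition 20, for a fixed `δ` with constants `C`, `D`,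
`T₀` (the shape in which it is consumed). [cite: BalazardRoton2008, Prop. 20] -/
def Prop20With (δ C D T₀ : ℝ) : Prop :=
  ∀ T : ℝ, T₀ ≤ T → ∀ V : ℝ,
    2 * Real.log (Real.log T) ^ 2 ≤ V → V ≤ Real.log T / Real.log (Real.log T) →
    ∀ S : Finset ℝ, (∀ t ∈ S, T ≤ t ∧ t ≤ 2 * T ∧ ¬IsTypical δ T V t) →
      (∀ t ∈ S, ∀ t' ∈ S, t ≠ t' → 1 ≤ |t - t'|) →
      (S.card : ℝ) ≤ C * T * Real.exp (-(V * Real.log (V / Real.log (Real.log T))) +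
        2 * V * Real.log (Real.log V) + D * V)

variable {δ C D T₀ : ℝ} {T : ℕ} {V : ℕ}

open Classical in
/-- The atypical witnesses `t_n ∈ [n, n+1]` for `n` with `V_n = V` (and junk elsewhere). [folklore] -/
def witness (δ : ℝ) (T V n : ℕ) : ℝ :=
  if h : ∃ t : ℝ, (n : ℝ) ≤ t ∧ t ≤ n + 1 ∧ ¬IsTypical δ T ((V - 1 : ℕ) : ℝ) t then Classical.choose h else n

/-- The defining property of `witness`. [folklore] -/
lemma witness_spec {n : ℕ} (h : ∃ t : ℝ, (n : ℝ) ≤ t ∧ t ≤ n + 1 ∧ ¬IsTypical δ T ((V - 1 : ℕ) : ℝ) t) :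
    (n : ℝ) ≤ witness δ T V n ∧ witness δ T V n ≤ n + 1 ∧ ¬IsTypical δ T ((V - 1 : ℕ) : ℝ) (witness δ T V n) := by
  classical
  have e : witness δ T V n = Classical.choose h := by
    rw [witness, dif_pos h]
  rw [e]
  exact Classical.choose_spec h

/-- For `n` in the level set: `V_n = V ≥ 1` with `(log log T)² ≤ V − 1` gives a witness. [folklore] -/
lemma exists_witness {n : ℕ} (hex : ∃ W : ℕ, Admissible δ T n W) (hlad : ladder δ (T : ℝ) n = V)
    (hV1 : 1 ≤ V) (hlow : Real.log (Real.log (T : ℝ)) ^ 2 ≤ ((V - 1 : ℕ) : ℝ)) :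
    ∃ t : ℝ, (n : ℝ) ≤ t ∧ t ≤ n + 1 ∧ ¬IsTypical δ T ((V - 1 : ℕ) : ℝ) t := by
  have h := exists_not_typical (δ := δ) (T := (T : ℝ)) (n := n) hex (by rw [hlad]; exact hV1)
    (by rw [hlad]; exact hlow)
  rw [hlad] at h
  exact h

/-- **The level-set count** (Balazard–de Roton 2008, §8.4 from Prop. 20). Assume `h20 : Prop20With δ C D T₀`
with `C ≥ 0`, `T ≥ T₀` a natural number, an integer `V` with `2(log log T)² + 1 ≤ V`, and that every
`[n, n+1] ⊆ [T, 2T]` admits an admissible integer. Then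
`#{n ∈ [T, 2T[ : V_n = V} ≤ 2·C·T·exp(−(V−1)log((V−1)/log log T) + 2(V−1) log log(V−1) + D(V−1))`.
[cite: BalazardRoton2008, §8.4 (proof of Prop. 24)] -/
theorem card_ladder_eq_le (h20 : Prop20With δ C D T₀) (hC : 0 ≤ C) (hT : T₀ ≤ (T : ℝ))
    (hV : 2 * Real.log (Real.log (T : ℝ)) ^ 2 + 1 ≤ (V : ℝ))
    (hex : ∀ n ∈ Finset.Ico T (2 * T), ∃ W : ℕ, Admissible δ T n W) :
    ((((Finset.Ico T (2 * T)).filter fun n ↦ ladder δ (T : ℝ) n = V).card : ℕ) : ℝ) ≤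
      2 * C * T * Real.exp (-(((V - 1 : ℕ) : ℝ) * Real.log (((V - 1 : ℕ) : ℝ) / Real.log (Real.log (T : ℝ)))) +
        2 * ((V - 1 : ℕ) : ℝ) * Real.log (Real.log ((V - 1 : ℕ) : ℝ)) + D * ((V - 1 : ℕ) : ℝ)) := by
  classical
  set L := (Finset.Ico T (2 * T)).filter fun n ↦ ladder δ (T : ℝ) n = V with hL
  set E : ℝ := Real.exp (-(((V - 1 : ℕ) : ℝ) * Real.log (((V - 1 : ℕ) : ℝ) / Real.log (Real.log (T : ℝ)))) +
        2 * ((V - 1 : ℕ) : ℝ) * Real.log (Real.log ((V - 1 : ℕ) : ℝ)) + D * ((V - 1 : ℕ) : ℝ)) with hE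
  have hsq0 : 0 ≤ Real.log (Real.log (T : ℝ)) ^ 2 := sq_nonneg _
  have hV1 : 1 ≤ V := by
    have : (1 : ℝ) ≤ V := by linarith
    exact_mod_cast this
  have hVm1 : ((V - 1 : ℕ) : ℝ) = (V : ℝ) - 1 := by rw [Nat.cast_sub hV1, Nat.cast_one]
  have hlow2 : 2 * Real.log (Real.log (T : ℝ)) ^ 2 ≤ ((V - 1 : ℕ) : ℝ) := by rw [hVm1]; linarith
  have hlow : Real.log (Real.log (T : ℝ)) ^ 2 ≤ ((V - 1 : ℕ) : ℝ) := by linarith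
  -- members of the level set have witnesses
  have hmem : ∀ n ∈ L, n ∈ Finset.Ico T (2 * T) ∧ ladder δ (T : ℝ) n = V := fun n hn ↦ by
    simpa [hL] using hn
  have hw : ∀ n ∈ L, (n : ℝ) ≤ witness δ T V n ∧ witness δ T V n ≤ n + 1 ∧
      ¬IsTypical δ T ((V - 1 : ℕ) : ℝ) (witness δ T V n) := fun n hn ↦
    witness_spec (exists_witness (hex n (hmem n hn).1) (hmem n hn).2 hV1 hlow)
  -- the upper bound `V − 1 ≤ log T/log log T` from admissibility of `V_n` (for a nonempty level set)
  -- parity classes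
  have hclass : ∀ i : ℕ, (((L.filter fun n ↦ n % 2 = i).card : ℕ) : ℝ) ≤ C * T * E := by
    intro i
    set P := L.filter fun n ↦ n % 2 = i with hP
    have hPL : ∀ n ∈ P, n ∈ L := fun n hn ↦ (Finset.mem_filter.1 hn).1
    -- spacing within a parity class
    have hsp : ∀ n ∈ P, ∀ m ∈ P, n < m → 1 ≤ witness δ T V m - witness δ T V n := by
      intro n hn m hm hnm
      have hn2 := (Finset.mem_filter.1 hn).2
      have hm2 := (Finset.mem_filter.1 hm).2
      have h2 : n + 2 ≤ m := by omega
      have hwn := hw n (hPL n hn)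
      have hwm := hw m (hPL m hm)
      have : (n : ℝ) + 2 ≤ m := by exact_mod_cast h2
      linarith [hwn.2.1, hwm.1]
    have hinj : Set.InjOn (witness δ T V) P := by
      intro n hn m hm heq
      by_contra hne
      rcases lt_or_gt_of_ne hne with h | h
      · have := hsp n hn m hm h; rw [heq] at this; linarith
      · have := hsp m hm n hn h; rw [heq] at this; linarith
    set S := P.image (witness δ T V) with hS
    have hcard : S.card = P.card := Finset.card_image_of_injOn hinj
    rcases P.eq_empty_or_nonempty with hPe | hPne
    · rw [hPe, Finset.card_empty, Nat.cast_zero]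
      exact mul_nonneg (mul_nonneg hC (Nat.cast_nonneg T)) (Real.exp_pos _).le
    -- `V − 1 ≤ log T / log log T`
    obtain ⟨n₀, hn₀⟩ := hPne
    have hup : ((V - 1 : ℕ) : ℝ) ≤ Real.log (T : ℝ) / Real.log (Real.log (T : ℝ)) := by
      have hn₀L := hPL n₀ hn₀
      have hadm := admissible_ladder (hex n₀ (hmem n₀ hn₀L).1)
      have h2 := hadm.2.1
      rw [(hmem n₀ hn₀L).2] at h2
      have : ((V - 1 : ℕ) : ℝ) ≤ (V : ℝ) := by rw [hVm1]; linarith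
      exact this.trans h2
    have hSmem : ∀ t ∈ S, (T : ℝ) ≤ t ∧ t ≤ 2 * (T : ℝ) ∧ ¬IsTypical δ T ((V - 1 : ℕ) : ℝ) t := by
      intro t ht
      rw [hS, Finset.mem_image] at ht
      obtain ⟨n, hn, rfl⟩ := ht
      have hwn := hw n (hPL n hn)
      have hnI := (hmem n (hPL n hn)).1
      rw [Finset.mem_Ico] at hnI
      have h1 : (T : ℝ) ≤ n := by exact_mod_cast hnI.1
      have h2 : (n : ℝ) + 1 ≤ 2 * (T : ℝ) := by
        have : n + 1 ≤ 2 * T := hnI.2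
        exact_mod_cast this
      exact ⟨h1.trans hwn.1, hwn.2.1.trans h2, hwn.2.2⟩
    have hSsp : ∀ t ∈ S, ∀ t' ∈ S, t ≠ t' → 1 ≤ |t - t'| := by
      intro t ht t' ht' htt'
      rw [hS, Finset.mem_image] at ht ht'
      obtain ⟨n, hn, rfl⟩ := ht
      obtain ⟨m, hm, rfl⟩ := ht'
      have hnm : n ≠ m := fun h ↦ htt' (by rw [h])
      rcases lt_or_gt_of_ne hnm with h | h
      · have := hsp n hn m hm h
        rw [abs_sub_comm]; exact this.trans (le_abs_self _)
      · have := hsp m hm n hn h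
        exact this.trans (le_abs_self _)
    have h := h20 (T : ℝ) hT ((V - 1 : ℕ) : ℝ) hlow2 hup S hSmem hSsp
    rw [hcard] at h
    rw [hE]
    exact h
  -- total = sum of the two parity classes
  have hsplit : L.card = (L.filter fun n ↦ n % 2 = 0).card + (L.filter fun n ↦ n % 2 = 1).card := by
    rw [← Finset.card_union_of_disjoint]
    · congr 1
      ext n
      simp only [Finset.mem_union, Finset.mem_filter]
      constructor
      · intro hn
        rcases Nat.mod_two_eq_zero_or_one n with h | h
        · exact Or.inl ⟨hn, h⟩
        · exact Or.inr ⟨hn, h⟩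
      · rintro (⟨hn, -⟩ | ⟨hn, -⟩) <;> exact hn
    · rw [Finset.disjoint_left]
      intro n h0 h1
      rw [Finset.mem_filter] at h0 h1
      omega
  have h0 := hclass 0
  have h1 := hclass 1
  rw [hsplit, Nat.cast_add]
  have : 2 * C * (T : ℝ) * E = C * T * E + C * T * E := by ring
  rw [this]
  exact add_le_add h0 h1

end TypicalCounting

end Literature.NumberTheory.LFunctions

end
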